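import Mathlib
import Summits.Ventures.HodgeRepro2.Tier7.Target
import Summits.Ventures.HodgeRepro2.Tier7.Common.Datum
import Summits.Ventures.HodgeRepro2.Tier7.Line1.Defs
import Summits.Ventures.HodgeRepro2.Tier7.Line1.TwoTorus
import Summits.Ventures.HodgeRepro2.Tier7.Line1.CupProduct
import Summits.Ventures.HodgeRepro2.Tier7.Line1.Seesaw
import Summits.Ventures.HodgeRepro2.Tier7.Line1.WedgeNonzero

/-!
# Tier7/Line1/WedgeSeesaw — the input `WedgeNonzero` as the FIRST RUNG of the device (t7-L1-p4)

Cell pub-hodge-repro2, Tier 7, LINE L1, prover t7-L1-p4 (lead l. 14745 (5): «L1: p4 WedgeNonzero (the A-product is a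
non-zero form — the first rung of the device: `δ_{T_A,μ_A} ≠ 0`)»). Sorry-free. Imports: the landed L1 API
(`Line1.Defs`, `Line1.TwoTorus`), t7-L1-p1's `Line1.CupProduct` (`prodModS_eq_mul`, `OrthDistinct`) and `Line1.Seesaw`
(`SeesawInput`, `twoTorusData_of_seesaw`), and `Line1.WedgeNonzero`.

CONTENT. (1) `wedgeNonzero_iff_mul_ne_bot : WedgeNonzero D ↔ D.omega 0 * D.omega 1 ≠ ⊥` — the input IS «the cup product
`ω(μ_0) ⊗ ω(μ_1) → H^{2,0}` is non-zero» (p1's `prodModS_eq_mul`; plan-1 l. 14726: «cite it rather than re-proving the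
density»). (2) THE FIRST RUNG: under the displayed seesaw input and the tower hypothesis `OrthDistinct`,
`wedgeNonzero_iff_exists_perA : WedgeNonzero D ↔ ∃ σ, h.perA σ ≠ 0` — the A-product is a non-zero form iff SOME
constituent `σ` of `U(W)` carries a non-zero `(T_A, μ_A)`-period, i.e. the period distribution `δ_{T_A,μ_A}` is
non-zero on the displayed spectrum. Proof: `P_A ≠ ⊥` ⇒ an irreducible `W ≤ P_A` ((H9)) ⇒ `W = desc σ` (`desc_surj`) ⇒
`perA σ ≠ 0` (p1's seesaw transfer `seesawA`, the `⇐` half); conversely `perA σ ≠ 0` ⇒ `desc σ ≤ P_A` ⇒ `P_A ≠ ⊥`.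
Likewise for the B-side. (3) The two rungs together: `CommonIrred`'s two-torus form needs ONE `σ` with both periods;
the first rungs give a `σ_A` and a `σ_B` separately — the gap between «both inputs hold» and the crux is exactly
«`σ_A = σ_B` for some choice», recorded as `two_torus_of_eq`.

STATUS: bookkeeping of the record — no non-vanishing is proved here (the inputs are consequences of (P)); the module
says in the device's vocabulary what the inputs are. §8(d): uses an L-value-free non-vanishing device: NO.
-/

namespace Summit.Ventures.HodgeRepro2.Tier7.Line1

open Summit.Ventures.HodgeRepro2.Tier7

noncomputable section

variable {K : Type} [Field K] [NumberField K] {E' : Type} [Field E'] [NumberField E']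
  {V : Type} [AddCommGroup V] [Module E' V] {HX : Type} [Ring HX] [Algebra ℂ HX]
  {G : Type} [Group G] [MulAction G HX] (D : PeriodDatum K E' V HX G)

/-! ## 1. The input as the non-vanishing of the cup product `ω(μ_0) ⊗ ω(μ_1) → H^{2,0}` -/

/-- `WedgeNonzero D ↔ ω(μ_0)·ω(μ_1) ≠ ⊥` (p1's `prodModS_eq_mul`: `P_A` is the cup-product image). -/
theorem wedgeNonzero_iff_mul_ne_bot : WedgeNonzero D ↔ D.omega 0 * D.omega 1 ≠ ⊥ := by
  rw [← prodModS_ne_bot_iff, prodModS_eq_mul]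

/-- `WedgeNonzeroBar D ↔ ω(μ_2)·ω(μ_3) ≠ ⊥`. -/
theorem wedgeNonzeroBar_iff_mul_ne_bot : WedgeNonzeroBar D ↔ D.omega 2 * D.omega 3 ≠ ⊥ := by
  rw [← prodModSbar_ne_bot_iff, prodModSbar_eq_mul]

/-! ## 2. The first rung: a non-zero A-product ⟺ a non-zero `(T_A, μ_A)`-period on the displayed spectrum -/

/-- a non-zero constituent's descent is not `⊥`, so a constituent inside `P_A` witnesses `P_A ≠ ⊥` -/
theorem wedgeNonzero_of_desc_le (h : SeesawInput D) (σ : h.Cons) (hle : h.desc σ ≤ prodModS D) :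
    WedgeNonzero D := by
  apply wedgeNonzero_of_ne_bot
  intro hbot
  apply (h.desc_irred σ).1
  rw [← le_bot_iff, ← hbot]
  exact hle

/-- the same for `P_B` -/
theorem wedgeNonzeroBar_of_desc_le (h : SeesawInput D) (σ : h.Cons) (hle : h.desc σ ≤ prodModSbar D) :
    WedgeNonzeroBar D := by
  apply wedgeNonzeroBar_of_ne_bot
  intro hbot
  apply (h.desc_irred σ).1
  rw [← le_bot_iff, ← hbot]
  exact hle

/-- THE FIRST RUNG (A-side): under the displayed seesaw input `h` and the tower hypothesis `OrthDistinct`, the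
A-product `θ(μ_0) ∧ θ(μ_1)` is a non-zero form for some Hecke translate iff some constituent `σ` of the displayed
spectrum has a non-zero `(T_A, μ_A)`-period. -/
theorem wedgeNonzero_iff_exists_perA (h : SeesawInput D) (ho : OrthDistinct D) :
    WedgeNonzero D ↔ ∃ σ : h.Cons, h.perA σ ≠ 0 := by
  constructor
  · intro hw
    obtain ⟨W, hWle, hWirr⟩ := exists_irred_le_prodModS_of_wedge D hw
    obtain ⟨σ, hσ⟩ := h.desc_surj W (hWle.trans (prodModS_le D)) hWirr
    refine ⟨σ, ?_⟩
    have := ((twoTorusData_of_seesaw D h ho).seesawA σ).mpr (by rw [twoTorusData_of_seesaw_desc, hσ]; exact hWle)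
    exact this
  · rintro ⟨σ, hσ⟩
    exact wedgeNonzero_of_desc_le D h σ (((twoTorusData_of_seesaw D h ho).seesawA σ).mp hσ)

/-- THE FIRST RUNG (B-side). -/
theorem wedgeNonzeroBar_iff_exists_perB (h : SeesawInput D) (ho : OrthDistinct D) :
    WedgeNonzeroBar D ↔ ∃ σ : h.Cons, h.perB σ ≠ 0 := by
  constructor
  · intro hw
    obtain ⟨W, hWle, hWirr⟩ := exists_irred_le_prodModSbar_of_wedge D hw
    obtain ⟨σ, hσ⟩ := h.desc_surj W (hWle.trans (prodModSbar_le D)) hWirr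
    refine ⟨σ, ?_⟩
    have := ((twoTorusData_of_seesaw D h ho).seesawB σ).mpr (by rw [twoTorusData_of_seesaw_desc, hσ]; exact hWle)
    exact this
  · rintro ⟨σ, hσ⟩
    exact wedgeNonzeroBar_of_desc_le D h σ (((twoTorusData_of_seesaw D h ho).seesawB σ).mp hσ)

/-! ## 3. The gap between the two first rungs and the crux -/

/-- the two first rungs give a `σ_A` with a non-zero A-period and a `σ_B` with a non-zero B-period; the crux is
the case `σ_A = σ_B`: if the two witnesses can be chosen equal, the two-torus statement (hence the crux and the
target) follows. -/
theorem two_torus_of_eq (h : SeesawInput D) (ho : OrthDistinct D) (hA : WedgeNonzero D) (hB : WedgeNonzeroBar D)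
    (heq : ∀ σA σB : h.Cons, h.perA σA ≠ 0 → h.perB σB ≠ 0 → ∃ σ : h.Cons, h.perA σ ≠ 0 ∧ h.perB σ ≠ 0) :
    TwoTorus D (twoTorusData_of_seesaw D h ho) := by
  obtain ⟨σA, hσA⟩ := (wedgeNonzero_iff_exists_perA D h ho).mp hA
  obtain ⟨σB, hσB⟩ := (wedgeNonzeroBar_iff_exists_perB D h ho).mp hB
  exact (two_torus_seesaw_iff D h ho).mpr (heq σA σB hσA hσB)

/-- conversely the two-torus statement gives both inputs -/
theorem wedgeNonzero_of_two_torus (h : SeesawInput D) (ho : OrthDistinct D)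
    (ht : TwoTorus D (twoTorusData_of_seesaw D h ho)) : WedgeNonzero D ∧ WedgeNonzeroBar D := by
  obtain ⟨σ, hA, hB⟩ := ht
  exact ⟨(wedgeNonzero_iff_exists_perA D h ho).mpr ⟨σ, hA⟩, (wedgeNonzeroBar_iff_exists_perB D h ho).mpr ⟨σ, hB⟩⟩

end

end Summit.Ventures.HodgeRepro2.Tier7.Line1
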